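import Literature.Analysis.FluidPDE.NSRobustnessOfRegularityAgmonBound
import HarnessLib

/-!
# Robustness of regularity on `ℝ³`, `AgmonBoundR3` RE-THREAD I: the `H¹` slice inequality in strain form
# with the Agmon constant as a PARAMETER `(hA : AgmonBoundR3 A)`

Analysis/FluidPDE proof file (theorems only; no definitions, no named facts, no `sorry`); first file of the
re-thread of the vein `NSRobustnessOfRegularity{,H2,SupNorm}` (ns-blowup-lit g17) + its smoothing files
(`…HalfFlux`, `…Dissipation`, `…H2Smoothing`, `…H2SmoothingWindow`, `…SmoothingSupNorm`, this seat) over the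
contract `AgmonBoundR3 A` (`NSRobustnessOfRegularityAgmonBound`, LEAD `ns-palasek-20303-p1`), asked because the
tree's `agmonConst` has no provable numerical value while an explicit `AgmonBoundR3 (√2/π)` is proved Summits-side.

* `robustness_flux_le_strain_of_agmonBound` — VERBATIM `robustness_flux_le_strain_R3` (RRS 2016, proof of Thm 9.1,
  Step 1, transport integrated out) with `agmonConst` replaced by any `A` with `AgmonBoundR3 A` and the four `L²`
  finiteness hypotheses `Dⁿw ∈ L²`, `n ≤ 3`, replaced by `∀ n` (what the contract consumes; every caller of the vein
  holds all orders from the Tao class):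
  `−2νY + 2∫⟪(v·∇)w + (w·∇)u, Δw⟫ + 2∫⟪h, Δw⟫ ≤ (4G + 3κσ₂)X + A⁴X³/(2ν³) + (2/ν)∫‖h‖² + (3σ₂/κ)L²`.
  At `A = agmonConst` (`agmonBoundR3_agmonConst`) it is the accepted lemma. The slice calculus (§A–§C) is the
  vein's private calculus COPIED verbatim (private declarations cannot be imported or re-opened append-only).

Follow-ups of the re-thread (not here): `classicalNS_robustness_strain(_window(_of_le))_of_agmonBound`, the `H²` flux
and robustness, the sup-norm doors, then the smoothing files — see HOME/fc-prover2/README-g10.md §4 (cell `ns-blowup`).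
WHAT THIS IS NOT: not a statement about Navier–Stokes regularity or blow-up — slice calculus for two given
smooth fields.

## References

* J. C. Robinson, J. L. Rodrigo, W. Sadowski, *The Three-Dimensional Navier–Stokes Equations*, CUP 2016,
  Thm 9.1 (proof, Step 1, (9.2)–(9.3)), Thm 1.20. [RobinsonRodrigoSadowskiCUP2016]
* M. Dashti, J. C. Robinson, SIAM J. Numer. Anal. 46 (2008) 3136–3150, Thm 1. [DashtiRobinson2008]
-/

noncomputable section

open MeasureTheory Set Function Filter Topology InnerProductSpace
open scoped ENNReal NNReal ContDiff RealInnerProductSpace Laplacian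

namespace Literature.Analysis.FluidPDE

/-! ## §A Young's inequality in the two shapes of the printed proof (copies) -/

/-- `M √X √Y ≤ (ν/4) Y + M²X/ν` (`(νb − 2Ma)² ≥ 0`). [folklore] -/
private theorem r3rob_young_two {ν M X Y : ℝ} (hν : 0 < ν) (hX : 0 ≤ X) (hY : 0 ≤ Y) :
    M * Real.sqrt X * Real.sqrt Y ≤ ν / 4 * Y + M ^ 2 * X / ν := by
  have ha := Real.sq_sqrt hX
  have hb := Real.sq_sqrt hY
  set a := Real.sqrt X
  set b := Real.sqrt Y
  rw [← ha, ← hb]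
  have key : 0 ≤ (ν * b - 2 * M * a) ^ 2 := sq_nonneg _
  rw [show ν / 4 * b ^ 2 + M ^ 2 * a ^ 2 / ν = (ν ^ 2 * b ^ 2 + 4 * M ^ 2 * a ^ 2) / (4 * ν) by
    field_simp]
  rw [le_div_iff₀ (by positivity)]
  nlinarith [key]

/-- **The polynomial Young step** (RRS: "Young's inequality with exponents `4` and `4/3`"):
if `s ≥ 0` and `s⁴ ≤ K Y³` with `K, Y ≥ 0`, then `s ≤ εY + 27K/(256ε³)` for every `ε > 0`
(`(3p + c)⁴ − 256p³c = (p − c)²(81p² + 14pc + c²) ≥ 0`). [folklore] -/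
private theorem r3rob_young_quartic {s K Y ε : ℝ} (hs : 0 ≤ s) (hK : 0 ≤ K) (hY : 0 ≤ Y)
    (hε : 0 < ε) (h : s ^ 4 ≤ K * Y ^ 3) : s ≤ ε * Y + 27 * K / (256 * ε ^ 3) := by
  set c : ℝ := 27 * K / (256 * ε ^ 3) with hc
  have hc0 : 0 ≤ c := by positivity
  set p : ℝ := ε * Y / 3 with hp
  have hp0 : 0 ≤ p := by positivity
  have hamgm : 256 * p ^ 3 * c ≤ (3 * p + c) ^ 4 := by
    have hid : (3 * p + c) ^ 4 - 256 * p ^ 3 * c =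
        (p - c) ^ 2 * (81 * p ^ 2 + 14 * p * c + c ^ 2) := by ring
    have hnn : 0 ≤ (p - c) ^ 2 * (81 * p ^ 2 + 14 * p * c + c ^ 2) := by positivity
    linarith
  have he : 256 * p ^ 3 * c = K * Y ^ 3 := by
    rw [hp, hc]; field_simp; ring
  have h3p : 3 * p + c = ε * Y + c := by rw [hp]; ring
  have hle4 : s ^ 4 ≤ (ε * Y + c) ^ 4 := by
    rw [← h3p]
    exact h.trans (he ▸ hamgm)
  have hrhs : 0 ≤ ε * Y + c := by positivity
  exact (pow_le_pow_iff_left₀ hs hrhs (by norm_num)).1 hle4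


/-- `∫⁻‖c‖a‖‖² < ∞` from `∫⁻‖a‖² < ∞` (real-valued majorant form). [folklore] -/
private theorem r3rob_lintegral_sq_mul_norm_lt_top {G : Type*} [NormedAddCommGroup G]
    {a : EuclideanSpace ℝ (Fin 3) → G}
    (c : ℝ) (ha : ∫⁻ x, ‖a x‖ₑ ^ 2 < ⊤) : ∫⁻ x, ‖c * ‖a x‖‖ₑ ^ 2 < ⊤ := by
  have e : ∀ x, ‖c * ‖a x‖‖ₑ ^ 2 = ‖c‖ₑ ^ 2 * ‖a x‖ₑ ^ 2 := fun x => by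
    rw [enorm_mul, mul_pow, enorm_norm]
  simp_rw [e]
  rw [lintegral_const_mul' _ _ (ENNReal.pow_ne_top enorm_ne_top)]
  exact ENNReal.mul_lt_top (lt_top_iff_ne_top.2 (ENNReal.pow_ne_top enorm_ne_top)) ha

/-! ## §2 Cauchy–Schwarz for a convective term against a test field on `ℝ³` -/

/-- A continuous field with `∫‖k‖² < ∞` is in `L²`. [folklore] -/
private theorem r3rob_memLp_two {G : Type*} [NormedAddCommGroup G]
    {k : EuclideanSpace ℝ (Fin 3) → G}
    (hk : Continuous k) (hk0 : ∫⁻ x, ‖k x‖ₑ ^ 2 < ⊤) : MemLp k 2 volume :=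
  (memLp_two_iff_integrable_sq_norm hk.aestronglyMeasurable).2
    (FluidPDE.integrable_sq_norm_of_lintegral_lt_top hk hk0)

/-- Pointwise: `‖(f·∇)h (x)‖ ≤ ‖f(x)‖ (|∇h(x)|²_F)^{1/2}` (`‖Dh(x)a‖ ≤ ‖Dh(x)‖‖a‖` and the
operator norm is at most the Frobenius norm, `sq_opNorm_le_frobeniusNormSq`). [folklore] -/
private theorem norm_convect_le_mul_sqrt_frobeniusNormSq
    (f h : EuclideanSpace ℝ (Fin 3) → EuclideanSpace ℝ (Fin 3)) (x : EuclideanSpace ℝ (Fin 3)) :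
    ‖convect f h x‖ ≤ ‖f x‖ * Real.sqrt (frobeniusNormSq (fderiv ℝ h x)) := by
  have h1 : ‖convect f h x‖ ≤ ‖fderiv ℝ h x‖ * ‖f x‖ := by
    rw [convect]
    exact (fderiv ℝ h x).le_opNorm (f x)
  have h2 : ‖fderiv ℝ h x‖ ≤ Real.sqrt (frobeniusNormSq (fderiv ℝ h x)) := by
    refine Real.le_sqrt_of_sq_le ?_
    exact FluidPDE.sq_opNorm_le_frobeniusNormSq _
  calc ‖convect f h x‖ ≤ ‖fderiv ℝ h x‖ * ‖f x‖ := h1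
    _ ≤ Real.sqrt (frobeniusNormSq (fderiv ℝ h x)) * ‖f x‖ :=
        mul_le_mul_of_nonneg_right h2 (norm_nonneg _)
    _ = ‖f x‖ * Real.sqrt (frobeniusNormSq (fderiv ℝ h x)) := mul_comm _ _

/-- Integrability of a convective pairing: for continuous `f` with `‖f‖ ≤ M`, `h ∈ C¹` with
`∫|∇h|²_F < ∞` and continuous `k ∈ L²`, `⟪(f·∇)h, k⟫ ∈ L¹(ℝ³)`. [folklore] -/
private theorem integrable_inner_convect_of_norm_le
    {f h k : EuclideanSpace ℝ (Fin 3) → EuclideanSpace ℝ (Fin 3)} (hf : Continuous f)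
    (hh : ContDiff ℝ 1 h) (hk : Continuous k) {M : ℝ} (hM0 : 0 ≤ M) (hM : ∀ x, ‖f x‖ ≤ M)
    (hh1 : ∫⁻ x, ENNReal.ofReal (frobeniusNormSq (fderiv ℝ h x)) < ⊤)
    (hk0 : ∫⁻ x, ‖k x‖ₑ ^ 2 < ⊤) :
    Integrable (fun x => ⟪convect f h x, k x⟫) volume := by
  set gF : EuclideanSpace ℝ (Fin 3) → ℝ :=
    fun x => M * Real.sqrt (frobeniusNormSq (fderiv ℝ h x)) with hgF
  have cfrob : Continuous fun x => frobeniusNormSq (fderiv ℝ h x) :=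
    FluidPDE.continuous_frobeniusNormSq_fderiv hh one_ne_zero
  have cgF : Continuous gF := continuous_const.mul cfrob.sqrt
  have hgF0 : ∀ x, 0 ≤ gF x := fun x => mul_nonneg hM0 (Real.sqrt_nonneg _)
  have hgF2 : ∫⁻ x, ‖gF x‖ₑ ^ 2 < ⊤ := by
    have e : ∀ x, ‖gF x‖ₑ ^ 2 =
        ENNReal.ofReal (M ^ 2) * ENNReal.ofReal (frobeniusNormSq (fderiv ℝ h x)) := by
      intro x
      rw [Real.enorm_eq_ofReal (hgF0 x), ← ENNReal.ofReal_pow (hgF0 x), hgF, mul_pow,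
        Real.sq_sqrt (frobeniusNormSq_nonneg _), ENNReal.ofReal_mul (sq_nonneg _)]
    simp_rw [e]
    rw [lintegral_const_mul' _ _ ENNReal.ofReal_ne_top]
    exact ENNReal.mul_lt_top ENNReal.ofReal_lt_top hh1
  have cconv : Continuous (convect f h) := (hh.continuous_fderiv one_ne_zero).clm_apply hf
  refine integrable_of_norm_le_mul_of_lintegral_sq (cconv.inner hk).aestronglyMeasurable cgF hk
    hgF2 hk0 (fun x => ?_)
  calc ‖⟪convect f h x, k x⟫‖ ≤ ‖convect f h x‖ * ‖k x‖ := norm_inner_le_norm _ _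
    _ ≤ (‖f x‖ * Real.sqrt (frobeniusNormSq (fderiv ℝ h x))) * ‖k x‖ :=
        mul_le_mul_of_nonneg_right (norm_convect_le_mul_sqrt_frobeniusNormSq f h x) (norm_nonneg _)
    _ ≤ gF x * ‖k x‖ :=
        mul_le_mul_of_nonneg_right (mul_le_mul_of_nonneg_right (hM x) (Real.sqrt_nonneg _))
          (norm_nonneg _)
    _ = ‖gF x‖ * ‖k x‖ := by rw [Real.norm_of_nonneg (hgF0 x)]

/-- **Cauchy–Schwarz for a convective pairing on `ℝ³`** (RRS 2016, proof of Thm 9.1, Step 1,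
the Hölder step): for continuous `f` with `‖f‖ ≤ M`, `h ∈ C¹` with `∫|∇h|²_F < ∞` and continuous
`k ∈ L²`, `∫⟪(f·∇)h, k⟫ ≤ M (∫|∇h|²_F)^{1/2} (∫‖k‖²)^{1/2}`. [folklore] -/
private theorem integral_inner_convect_le_of_norm_le
    {f h k : EuclideanSpace ℝ (Fin 3) → EuclideanSpace ℝ (Fin 3)} (hh : ContDiff ℝ 1 h)
    (hk : Continuous k) {M : ℝ} (hM0 : 0 ≤ M) (hM : ∀ x, ‖f x‖ ≤ M)
    (hh1 : ∫⁻ x, ENNReal.ofReal (frobeniusNormSq (fderiv ℝ h x)) < ⊤)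
    (hk0 : ∫⁻ x, ‖k x‖ₑ ^ 2 < ⊤) :
    ∫ x, ⟪convect f h x, k x⟫ ≤
      M * Real.sqrt (∫ x, frobeniusNormSq (fderiv ℝ h x)) * Real.sqrt (∫ x, ‖k x‖ ^ 2) := by
  set gF : EuclideanSpace ℝ (Fin 3) → ℝ :=
    fun x => Real.sqrt (frobeniusNormSq (fderiv ℝ h x)) with hgF
  have cfrob : Continuous fun x => frobeniusNormSq (fderiv ℝ h x) :=
    FluidPDE.continuous_frobeniusNormSq_fderiv hh one_ne_zero
  have cgF : Continuous gF := cfrob.sqrt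
  have hgF0 : ∀ x, 0 ≤ gF x := fun x => Real.sqrt_nonneg _
  have hgFsq : ∀ x, gF x ^ 2 = frobeniusNormSq (fderiv ℝ h x) := fun x =>
    Real.sq_sqrt (frobeniusNormSq_nonneg _)
  -- `gF ∈ L²`
  have hgF2 : ∫⁻ x, ‖gF x‖ₑ ^ 2 < ⊤ := by
    refine lt_of_le_of_lt (le_of_eq (lintegral_congr fun x => ?_)) hh1
    rw [Real.enorm_eq_ofReal (hgF0 x), ← ENNReal.ofReal_pow (hgF0 x), hgFsq]
  have mgF : MemLp gF 2 volume := r3rob_memLp_two cgF hgF2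
  have mk : MemLp k 2 volume := r3rob_memLp_two hk hk0
  have hcs := integral_norm_mul_norm_le_sqrt_mul_sqrt mgF mk
  have e1 : ∫ x, ‖gF x‖ ^ 2 = ∫ x, frobeniusNormSq (fderiv ℝ h x) :=
    integral_congr_ae (Eventually.of_forall fun x => by
      dsimp only; rw [Real.norm_of_nonneg (hgF0 x), hgFsq])
  rw [e1] at hcs
  -- the pointwise bound
  have hpt : ∀ x, ⟪convect f h x, k x⟫ ≤ M * (‖gF x‖ * ‖k x‖) := by
    intro x
    calc ⟪convect f h x, k x⟫ ≤ ‖convect f h x‖ * ‖k x‖ := real_inner_le_norm _ _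
      _ ≤ (‖f x‖ * gF x) * ‖k x‖ :=
          mul_le_mul_of_nonneg_right (norm_convect_le_mul_sqrt_frobeniusNormSq f h x) (norm_nonneg _)
      _ ≤ (M * gF x) * ‖k x‖ :=
          mul_le_mul_of_nonneg_right (mul_le_mul_of_nonneg_right (hM x) (hgF0 x)) (norm_nonneg _)
      _ = M * (‖gF x‖ * ‖k x‖) := by rw [Real.norm_of_nonneg (hgF0 x)]; ring
  have hrhs0 : 0 ≤ M * Real.sqrt (∫ x, frobeniusNormSq (fderiv ℝ h x)) *
      Real.sqrt (∫ x, ‖k x‖ ^ 2) := by positivity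
  by_cases hint : Integrable (fun x => ⟪convect f h x, k x⟫) volume
  · have hint2 : Integrable (fun x => M * (‖gF x‖ * ‖k x‖)) volume := by
      refine Integrable.const_mul ?_ M
      exact integrable_of_norm_le_mul_of_lintegral_sq
        ((cgF.norm.mul hk.norm).aestronglyMeasurable) cgF hk hgF2 hk0
        (fun x => by rw [Real.norm_of_nonneg (mul_nonneg (norm_nonneg _) (norm_nonneg _))])
    calc ∫ x, ⟪convect f h x, k x⟫ ≤ ∫ x, M * (‖gF x‖ * ‖k x‖) := integral_mono hint hint2 hpt
      _ = M * ∫ x, ‖gF x‖ * ‖k x‖ := integral_const_mul _ _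
      _ ≤ M * (Real.sqrt (∫ x, frobeniusNormSq (fderiv ℝ h x)) * Real.sqrt (∫ x, ‖k x‖ ^ 2)) :=
          mul_le_mul_of_nonneg_left hcs hM0
      _ = M * Real.sqrt (∫ x, frobeniusNormSq (fderiv ℝ h x)) * Real.sqrt (∫ x, ‖k x‖ ^ 2) := by
          ring
  · rw [integral_undef hint]
    exact hrhs0

/-! ## §4b The slice inequality in STRAIN form: transport integrated out (the purchasable rate) -/

section Strain

/-- Linear algebra on `ℝ³`: `Σₖ ⟪B eₖ, B (A eₖ)⟫ = Σⱼ ⟪B†eⱼ, A (B†eⱼ)⟫` (both are the trace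
`tr(B†BA) = tr(BAB†)`). [folklore] -/
private theorem r3rob_sum_inner_comp_eq
    (A B : EuclideanSpace ℝ (Fin 3) →L[ℝ] EuclideanSpace ℝ (Fin 3)) :
    ∑ k, ⟪B (EuclideanSpace.basisFun (Fin 3) ℝ k), B (A (EuclideanSpace.basisFun (Fin 3) ℝ k))⟫ =
      ∑ j, ⟪(ContinuousLinearMap.adjoint B) (EuclideanSpace.basisFun (Fin 3) ℝ j),
        A ((ContinuousLinearMap.adjoint B) (EuclideanSpace.basisFun (Fin 3) ℝ j))⟫ := by
  set e := EuclideanSpace.basisFun (Fin 3) ℝ with he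
  set Bd := ContinuousLinearMap.adjoint B with hBd
  have h1 : ∑ k, ⟪B (e k), B (A (e k))⟫ =
      LinearMap.trace ℝ (EuclideanSpace ℝ (Fin 3))
        ((Bd : EuclideanSpace ℝ (Fin 3) →ₗ[ℝ] EuclideanSpace ℝ (Fin 3)) ∘ₗ
          ((B : EuclideanSpace ℝ (Fin 3) →ₗ[ℝ] EuclideanSpace ℝ (Fin 3)) ∘ₗ
            (A : EuclideanSpace ℝ (Fin 3) →ₗ[ℝ] EuclideanSpace ℝ (Fin 3)))) := by
    rw [LinearMap.trace_eq_sum_inner _ e]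
    refine Finset.sum_congr rfl fun k _ => ?_
    simp only [LinearMap.coe_comp, Function.comp_apply, ContinuousLinearMap.coe_coe]
    rw [hBd, ContinuousLinearMap.adjoint_inner_right]
  have h2 : ∑ j, ⟪Bd (e j), A (Bd (e j))⟫ =
      LinearMap.trace ℝ (EuclideanSpace ℝ (Fin 3))
        (((B : EuclideanSpace ℝ (Fin 3) →ₗ[ℝ] EuclideanSpace ℝ (Fin 3)) ∘ₗ
            (A : EuclideanSpace ℝ (Fin 3) →ₗ[ℝ] EuclideanSpace ℝ (Fin 3))) ∘ₗ
          (Bd : EuclideanSpace ℝ (Fin 3) →ₗ[ℝ] EuclideanSpace ℝ (Fin 3))) := by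
    rw [LinearMap.trace_eq_sum_inner _ e]
    refine Finset.sum_congr rfl fun j _ => ?_
    simp only [LinearMap.coe_comp, Function.comp_apply, ContinuousLinearMap.coe_coe]
    rw [hBd, ContinuousLinearMap.adjoint_inner_left]
  rw [h1, h2, LinearMap.trace_comp_comm']

/-- `frobeniusNormSq B† = frobeniusNormSq B` on `ℝ³` (Parseval twice). [folklore] -/
private theorem r3rob_frobeniusNormSq_adjoint
    (B : EuclideanSpace ℝ (Fin 3) →L[ℝ] EuclideanSpace ℝ (Fin 3)) :
    frobeniusNormSq (ContinuousLinearMap.adjoint B) = frobeniusNormSq B := by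
  set e := EuclideanSpace.basisFun (Fin 3) ℝ with he
  have hsq : ∀ x : EuclideanSpace ℝ (Fin 3), ‖x‖ ^ 2 = ∑ k, ⟪x, e k⟫ ^ 2 := fun x => by
    rw [EuclideanSpace.real_norm_sq_eq]
    refine Finset.sum_congr rfl fun k _ => ?_
    rw [he, EuclideanSpace.basisFun_apply, EuclideanSpace.inner_single_right]
    simp
  rw [frobeniusNormSq_eq_sum e, frobeniusNormSq_eq_sum e]
  simp_rw [hsq]
  rw [Finset.sum_comm]
  refine Finset.sum_congr rfl fun k _ => Finset.sum_congr rfl fun j _ => ?_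
  rw [ContinuousLinearMap.adjoint_inner_left, real_inner_comm]

/-- The first quadratic form: `−Σₖ ⟪B eₖ, B (A eₖ)⟫ ≤ G |B|²_F` if `−⟪Aξ, ξ⟫ ≤ G‖ξ‖²` for all `ξ`
(`A = Du`, `B = Dw`: the form `−Σᵢ ⟪∇wᵢ, Du ∇wᵢ⟫` of the transport term after integration by
parts). [folklore] -/
private theorem r3rob_neg_sum_inner_comp_le
    (A B : EuclideanSpace ℝ (Fin 3) →L[ℝ] EuclideanSpace ℝ (Fin 3)) {G : ℝ}
    (hG : ∀ ξ : EuclideanSpace ℝ (Fin 3), -⟪A ξ, ξ⟫ ≤ G * ‖ξ‖ ^ 2) :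
    -∑ k, ⟪B (EuclideanSpace.basisFun (Fin 3) ℝ k), B (A (EuclideanSpace.basisFun (Fin 3) ℝ k))⟫ ≤
      G * frobeniusNormSq B := by
  set e := EuclideanSpace.basisFun (Fin 3) ℝ with he
  set Bd := ContinuousLinearMap.adjoint B with hBd
  rw [r3rob_sum_inner_comp_eq A B, ← r3rob_frobeniusNormSq_adjoint B, frobeniusNormSq_eq_sum e,
    Finset.mul_sum, ← Finset.sum_neg_distrib]
  refine Finset.sum_le_sum fun j _ => ?_
  rw [real_inner_comm]
  exact hG _

/-- The second quadratic form: `−Σₖ ⟪B eₖ, A (B eₖ)⟫ ≤ G |B|²_F` if `−⟪Aξ, ξ⟫ ≤ G‖ξ‖²` (the form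
`−Σₖ ⟪∂ₖw, Du ∂ₖw⟫` of the stretching term). [folklore] -/
private theorem r3rob_neg_sum_inner_le
    (A B : EuclideanSpace ℝ (Fin 3) →L[ℝ] EuclideanSpace ℝ (Fin 3)) {G : ℝ}
    (hG : ∀ ξ : EuclideanSpace ℝ (Fin 3), -⟪A ξ, ξ⟫ ≤ G * ‖ξ‖ ^ 2) :
    -∑ k, ⟪B (EuclideanSpace.basisFun (Fin 3) ℝ k), A (B (EuclideanSpace.basisFun (Fin 3) ℝ k))⟫ ≤
      G * frobeniusNormSq B := by
  set e := EuclideanSpace.basisFun (Fin 3) ℝ with he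
  rw [frobeniusNormSq_eq_sum e, Finset.mul_sum, ← Finset.sum_neg_distrib]
  refine Finset.sum_le_sum fun k _ => ?_
  rw [real_inner_comm]
  exact hG _

variable {u w : EuclideanSpace ℝ (Fin 3) → EuclideanSpace ℝ (Fin 3)}

/-- **The product rule for the convective term** on `ℝ³` (smooth fields):
`∂ₑ((a·∇)b) = Db(∂ₑa) + (a·∇)(∂ₑb)` (the tree's `fderiv_convect_apply_eqOn` on `univ`). [folklore] -/
private theorem fderiv_convect_apply_of_contDiff
    {a b : EuclideanSpace ℝ (Fin 3) → EuclideanSpace ℝ (Fin 3)} (ha : ContDiff ℝ ∞ a)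
    (hb : ContDiff ℝ ∞ b)
    (x ξ : EuclideanSpace ℝ (Fin 3)) :
    fderiv ℝ (convect a b) x ξ =
      fderiv ℝ b x (fderiv ℝ a x ξ) + convect a (fun y => fderiv ℝ b y ξ) x := by
  have h := fderiv_convect_apply_eqOn isOpen_univ ha.contDiffOn hb.contDiffOn ξ (mem_univ x)
  simpa [convect] using h

/-- **The transport trilinear term, integrated by parts** (cstrat-19179's (I1); Beirão da Veiga /
Berselli–Galdi's `∫Δu·(u·∇)u = −Σ∂ₖuⱼ∂ⱼuᵢ∂ₖuᵢ` with two different fields): for `C^∞` fields `u, w`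
on `ℝ³` with `div u = 0`, `u, Du` bounded and `Dw, D²w ∈ L²`,
`∫ ⟪Δw, (u·∇)w⟫ = −Σᵢ ∫ ⟪∂ᵢw, Dw(∂ᵢu)⟫` — the transport term `∫⟪∂ᵢw, (u·∇)∂ᵢw⟫` vanishes
(`integral_inner_convect_transport_eq_zero`). [folklore] -/
private theorem integral_inner_laplacian_convect_left_eq_neg_sum (hu : ContDiff ℝ ∞ u) (hw : ContDiff ℝ ∞ w)
    (hdiv : VectorCalculus.IsDivFree u) {B : ℝ} (hB : ∀ x, ‖u x‖ ≤ B)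
    {B₁ : ℝ} (hB₁ : ∀ x, ‖fderiv ℝ u x‖ ≤ B₁)
    (hw1 : ∫⁻ x, ‖iteratedFDeriv ℝ 1 w x‖ₑ ^ 2 < ⊤) (hw2 : ∫⁻ x, ‖iteratedFDeriv ℝ 2 w x‖ₑ ^ 2 < ⊤) :
    (Integrable (fun x => ∑ i, ⟪fderiv ℝ w x (EuclideanSpace.basisFun (Fin 3) ℝ i),
        fderiv ℝ w x (fderiv ℝ u x (EuclideanSpace.basisFun (Fin 3) ℝ i))⟫) volume) ∧
    ∫ x, ⟪(Δ w) x, convect u w x⟫ =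
      - ∫ x, ∑ i, ⟪fderiv ℝ w x (EuclideanSpace.basisFun (Fin 3) ℝ i),
          fderiv ℝ w x (fderiv ℝ u x (EuclideanSpace.basisFun (Fin 3) ℝ i))⟫ := by
  set e := EuclideanSpace.basisFun (Fin 3) ℝ with he
  have he1 : ∀ i, ‖e i‖ = 1 := fun i => by simp [he]
  have hB0 : 0 ≤ B := (norm_nonneg _).trans (hB 0)
  have hB₁0 : 0 ≤ B₁ := (norm_nonneg _).trans (hB₁ 0)
  have hw2' : ContDiff ℝ 2 w := hw.of_le (by norm_cast)
  have hw1' : ContDiff ℝ 1 w := hw.of_le (by norm_cast)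
  have hu1' : ContDiff ℝ 1 u := hu.of_le (by norm_cast)
  obtain ⟨F, hFdef⟩ : ∃ F : EuclideanSpace ℝ (Fin 3) → EuclideanSpace ℝ (Fin 3),
      F = convect u w := ⟨_, rfl⟩
  have hF : ContDiff ℝ 1 F := by
    rw [hFdef]; exact (hw.fderiv_right (m := 1) (by norm_cast)).clm_apply hu1'
  -- slices
  obtain ⟨ws, hws⟩ : ∃ ws : Fin 3 → EuclideanSpace ℝ (Fin 3) → EuclideanSpace ℝ (Fin 3),
      ws = fun i y => fderiv ℝ w y (e i) := ⟨_, rfl⟩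
  have hws2 : ∀ i, ContDiff ℝ 2 (ws i) := fun i => by
    rw [hws]; exact (hw.fderiv_right (m := 2) (by norm_cast)).clm_apply contDiff_const
  have hws1 : ∀ i, ContDiff ℝ 1 (ws i) := fun i => (hws2 i).of_le (by norm_num)
  have hwsinf : ∀ i, ContDiff ℝ ∞ (ws i) := fun i => by
    rw [hws]; exact (hw.fderiv_right (m := ∞) (by norm_cast)).clm_apply contDiff_const
  -- continuity
  have cu : Continuous u := hu.continuous
  have cDu : Continuous (fderiv ℝ u) := hu1'.continuous_fderiv one_ne_zero
  have cDw : Continuous (fderiv ℝ w) := hw1'.continuous_fderiv one_ne_zero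
  have cws : ∀ i, Continuous (ws i) := fun i => (hws1 i).continuous
  have cDws : ∀ i, Continuous (fderiv ℝ (ws i)) := fun i => (hws1 i).continuous_fderiv one_ne_zero
  have cddw : ∀ i, Continuous fun x => fderiv ℝ (ws i) x (e i) := fun i =>
    (cDws i).clm_apply continuous_const
  have cF : Continuous F := by rw [hFdef]; exact cDw.clm_apply cu
  have cDF : Continuous (fderiv ℝ F) := hF.continuous_fderiv one_ne_zero
  -- pointwise norm bounds
  have hDw_eq : ∀ x, ‖fderiv ℝ w x‖ = ‖iteratedFDeriv ℝ 1 w x‖ := fun x => by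
    rw [← norm_iteratedFDeriv_fderiv, norm_iteratedFDeriv_zero]
  have n_ws : ∀ i x, ‖ws i x‖ ≤ ‖fderiv ℝ w x‖ := fun i x => by
    rw [hws]; simpa [he1] using (fderiv ℝ w x).le_opNorm (e i)
  have n_Dws : ∀ i x, ‖fderiv ℝ (ws i) x‖ ≤ ‖iteratedFDeriv ℝ 2 w x‖ := fun i x => by
    have h : ‖fderiv ℝ (ws i) x‖ = ‖iteratedFDeriv ℝ 1 (ws i) x‖ := by
      rw [← norm_iteratedFDeriv_fderiv, norm_iteratedFDeriv_zero]
    rw [h, hws]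
    exact norm_iteratedFDeriv_fderiv_apply_basisFun_le hw 1 (by norm_cast) x i
  have n_ddw : ∀ i x, ‖fderiv ℝ (ws i) x (e i)‖ ≤ ‖iteratedFDeriv ℝ 2 w x‖ := fun i x => by
    have h1 : ‖fderiv ℝ (ws i) x (e i)‖ ≤ ‖fderiv ℝ (ws i) x‖ := by
      simpa [he1] using (fderiv ℝ (ws i) x).le_opNorm (e i)
    exact h1.trans (n_Dws i x)
  have n_F : ∀ x, ‖F x‖ ≤ ‖B * ‖fderiv ℝ w x‖‖ := fun x => by
    rw [hFdef, convect, Real.norm_of_nonneg (mul_nonneg hB0 (norm_nonneg _)), mul_comm]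
    exact (fderiv ℝ w x).le_opNorm_of_le (hB x)
  -- finite `L²` norms
  have l2Dw : ∫⁻ x, ‖fderiv ℝ w x‖ₑ ^ 2 < ⊤ :=
    lintegral_enorm_sq_lt_top_of_norm_le (fun x => (hDw_eq x).le) hw1
  have l2ws : ∀ i, ∫⁻ x, ‖ws i x‖ₑ ^ 2 < ⊤ := fun i => lintegral_enorm_sq_lt_top_of_norm_le (n_ws i) l2Dw
  have l2Dws : ∀ i, ∫⁻ x, ‖fderiv ℝ (ws i) x‖ₑ ^ 2 < ⊤ := fun i =>
    lintegral_enorm_sq_lt_top_of_norm_le (n_Dws i) hw2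
  have l2ddw : ∀ i, ∫⁻ x, ‖fderiv ℝ (ws i) x (e i)‖ₑ ^ 2 < ⊤ := fun i =>
    lintegral_enorm_sq_lt_top_of_norm_le (n_ddw i) hw2
  have l2F : ∫⁻ x, ‖F x‖ₑ ^ 2 < ⊤ :=
    lintegral_enorm_sq_lt_top_of_norm_le n_F (r3rob_lintegral_sq_mul_norm_lt_top B l2Dw)
  -- the derivative of `F`: `∂ᵢF = Dw(∂ᵢu) + (u·∇)(∂ᵢw)`
  have hdF : ∀ i x, fderiv ℝ F x (e i) = fderiv ℝ w x (fderiv ℝ u x (e i)) + convect u (ws i) x := by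
    intro i x
    rw [hFdef, fderiv_convect_apply_of_contDiff hu hw x (e i), hws]
  -- the two pieces of `⟪wsᵢ, ∂ᵢF⟫` and their integrability
  have n_a : ∀ i x, ‖fderiv ℝ w x (fderiv ℝ u x (e i))‖ ≤ ‖B₁ * ‖fderiv ℝ w x‖‖ := fun i x => by
    rw [Real.norm_of_nonneg (mul_nonneg hB₁0 (norm_nonneg _)), mul_comm]
    refine (fderiv ℝ w x).le_opNorm_of_le ?_
    calc ‖fderiv ℝ u x (e i)‖ ≤ ‖fderiv ℝ u x‖ * ‖e i‖ := (fderiv ℝ u x).le_opNorm _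
      _ ≤ B₁ := by rw [he1, mul_one]; exact hB₁ x
  have n_b : ∀ i x, ‖convect u (ws i) x‖ ≤ ‖B * ‖fderiv ℝ (ws i) x‖‖ := fun i x => by
    rw [convect, Real.norm_of_nonneg (mul_nonneg hB0 (norm_nonneg _)), mul_comm]
    exact (fderiv ℝ (ws i) x).le_opNorm_of_le (hB x)
  have ca : ∀ i, Continuous fun x => fderiv ℝ w x (fderiv ℝ u x (e i)) := fun i =>
    cDw.clm_apply (cDu.clm_apply continuous_const)
  have cb : ∀ i, Continuous (convect u (ws i)) := fun i => (cDws i).clm_apply cu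
  have l2a : ∀ i, ∫⁻ x, ‖fderiv ℝ w x (fderiv ℝ u x (e i))‖ₑ ^ 2 < ⊤ := fun i =>
    lintegral_enorm_sq_lt_top_of_norm_le (n_a i) (r3rob_lintegral_sq_mul_norm_lt_top B₁ l2Dw)
  have l2b : ∀ i, ∫⁻ x, ‖convect u (ws i) x‖ₑ ^ 2 < ⊤ := fun i =>
    lintegral_enorm_sq_lt_top_of_norm_le (n_b i) (r3rob_lintegral_sq_mul_norm_lt_top B (l2Dws i))
  have i2a : ∀ i, Integrable (fun x => ⟪ws i x, fderiv ℝ w x (fderiv ℝ u x (e i))⟫) volume := fun i =>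
    integrable_of_norm_le_mul_of_lintegral_sq ((cws i).inner (ca i)).aestronglyMeasurable (cws i) (ca i)
      (l2ws i) (l2a i) fun x => norm_inner_le_norm _ _
  have i2b : ∀ i, Integrable (fun x => ⟪ws i x, convect u (ws i) x⟫) volume := fun i =>
    integrable_of_norm_le_mul_of_lintegral_sq ((cws i).inner (cb i)).aestronglyMeasurable (cws i) (cb i)
      (l2ws i) (l2b i) fun x => norm_inner_le_norm _ _
  -- integrability for the integration by parts
  have i1 : ∀ i, Integrable (fun x => ⟪fderiv ℝ (fun y => fderiv ℝ w y (e i)) x (e i), F x⟫)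
      volume := fun i => by
    have h : Integrable (fun x => ⟪fderiv ℝ (ws i) x (e i), F x⟫) volume :=
      integrable_of_norm_le_mul_of_lintegral_sq ((cddw i).inner cF).aestronglyMeasurable (cddw i)
        cF (l2ddw i) l2F fun x => norm_inner_le_norm _ _
    rw [hws] at h
    exact h
  have i2 : ∀ i, Integrable (fun x => ⟪fderiv ℝ w x (e i), fderiv ℝ F x (e i)⟫) volume := fun i => by
    have h := (i2a i).add (i2b i)
    refine h.congr (Eventually.of_forall fun x => ?_)
    simp only [Pi.add_apply, hdF i x, inner_add_right, hws]
  have i3 : ∀ i, Integrable (fun x => ⟪fderiv ℝ w x (e i), F x⟫) volume := fun i => by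
    have h : Integrable (fun x => ⟪ws i x, F x⟫) volume :=
      integrable_of_norm_le_mul_of_lintegral_sq ((cws i).inner cF).aestronglyMeasurable (cws i)
        cF (l2ws i) l2F fun x => norm_inner_le_norm _ _
    rw [hws] at h
    exact h
  -- integration by parts
  have hL := integral_sum_inner_fderiv_fderiv_eq_neg_integral_inner_laplacian hw2' hF i1 i2 i3
  -- the transport terms vanish
  have htr : ∀ i, ∫ x, ⟪ws i x, convect u (ws i) x⟫ = 0 := by
    intro i
    have hswap : (fun x => ⟪ws i x, convect u (ws i) x⟫) = fun x => ⟪convect u (ws i) x, ws i x⟫ :=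
      funext fun x => real_inner_comm _ _
    rw [hswap]
    exact integral_inner_convect_transport_eq_zero hu1' hdiv hB (hws1 i)
      (r3rob_memLp_two (cws i) (l2ws i)) (r3rob_memLp_two (cDws i) (l2Dws i))
  have hsplit : ∀ i, ∫ x, ⟪fderiv ℝ w x (e i), fderiv ℝ F x (e i)⟫ =
      ∫ x, ⟪ws i x, fderiv ℝ w x (fderiv ℝ u x (e i))⟫ := by
    intro i
    have h1 : (fun x => ⟪fderiv ℝ w x (e i), fderiv ℝ F x (e i)⟫) =
        fun x => ⟪ws i x, fderiv ℝ w x (fderiv ℝ u x (e i))⟫ + ⟪ws i x, convect u (ws i) x⟫ :=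
      funext fun x => by rw [hdF i x, inner_add_right, hws]
    rw [h1, integral_add (i2a i) (i2b i), htr i, add_zero]
  have hL' : ∫ x, ⟪(Δ w) x, F x⟫ = - ∫ x, ∑ i, ⟪fderiv ℝ w x (e i), fderiv ℝ F x (e i)⟫ := by
    rw [hL, neg_neg]
  have i2a' : ∀ i, Integrable (fun x => ⟪fderiv ℝ w x (e i), fderiv ℝ w x (fderiv ℝ u x (e i))⟫)
      volume := fun i => by
    have h := i2a i
    rw [hws] at h
    exact h
  refine ⟨integrable_finsetSum _ fun i _ => i2a' i, ?_⟩
  rw [← hFdef, hL', integral_finsetSum _ fun i _ => i2 i, Finset.sum_congr rfl fun i _ => hsplit i,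
    ← integral_finsetSum _ fun i _ => i2a i, hws]

/-- **The stretching trilinear term, integrated by parts** (cstrat-19179's (I2)): for `C^∞` fields
`u, w` on `ℝ³` with `Du, D²u` bounded and `w, Dw, D²w ∈ L²`,
`∫ ⟪Δw, (w·∇)u⟫ = −Σᵢ ∫ ⟪∂ᵢw, Du(∂ᵢw)⟫ − Σᵢ ∫ ⟪∂ᵢw, (w·∇)∂ᵢu⟫`. [folklore] -/
private theorem integral_inner_laplacian_convect_right_eq_neg_sum (hu : ContDiff ℝ ∞ u) (hw : ContDiff ℝ ∞ w)
    {B₁ : ℝ} (hB₁ : ∀ x, ‖fderiv ℝ u x‖ ≤ B₁) {B₂ : ℝ} (hB₂ : ∀ x, ‖iteratedFDeriv ℝ 2 u x‖ ≤ B₂)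
    (hw0 : ∫⁻ x, ‖w x‖ₑ ^ 2 < ⊤)
    (hw1 : ∫⁻ x, ‖iteratedFDeriv ℝ 1 w x‖ₑ ^ 2 < ⊤) (hw2 : ∫⁻ x, ‖iteratedFDeriv ℝ 2 w x‖ₑ ^ 2 < ⊤) :
    (Integrable (fun x => ∑ i, ⟪fderiv ℝ w x (EuclideanSpace.basisFun (Fin 3) ℝ i),
        fderiv ℝ u x (fderiv ℝ w x (EuclideanSpace.basisFun (Fin 3) ℝ i))⟫) volume) ∧
    (Integrable (fun x => ∑ i, ⟪fderiv ℝ w x (EuclideanSpace.basisFun (Fin 3) ℝ i),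
        convect w (fun y => fderiv ℝ u y (EuclideanSpace.basisFun (Fin 3) ℝ i)) x⟫) volume) ∧
    ∫ x, ⟪(Δ w) x, convect w u x⟫ =
      - (∫ x, ∑ i, ⟪fderiv ℝ w x (EuclideanSpace.basisFun (Fin 3) ℝ i),
          fderiv ℝ u x (fderiv ℝ w x (EuclideanSpace.basisFun (Fin 3) ℝ i))⟫)
      - ∫ x, ∑ i, ⟪fderiv ℝ w x (EuclideanSpace.basisFun (Fin 3) ℝ i),
          convect w (fun y => fderiv ℝ u y (EuclideanSpace.basisFun (Fin 3) ℝ i)) x⟫ := by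
  set e := EuclideanSpace.basisFun (Fin 3) ℝ with he
  have he1 : ∀ i, ‖e i‖ = 1 := fun i => by simp [he]
  have hB₁0 : 0 ≤ B₁ := (norm_nonneg _).trans (hB₁ 0)
  have hB₂0 : 0 ≤ B₂ := (norm_nonneg _).trans (hB₂ 0)
  have hw2' : ContDiff ℝ 2 w := hw.of_le (by norm_cast)
  have hw1' : ContDiff ℝ 1 w := hw.of_le (by norm_cast)
  have hu1' : ContDiff ℝ 1 u := hu.of_le (by norm_cast)
  have hu2' : ContDiff ℝ 2 u := hu.of_le (by norm_cast)
  obtain ⟨F, hFdef⟩ : ∃ F : EuclideanSpace ℝ (Fin 3) → EuclideanSpace ℝ (Fin 3),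
      F = convect w u := ⟨_, rfl⟩
  have hF : ContDiff ℝ 1 F := by
    rw [hFdef]; exact (hu.fderiv_right (m := 1) (by norm_cast)).clm_apply hw1'
  -- slices
  obtain ⟨ws, hws⟩ : ∃ ws : Fin 3 → EuclideanSpace ℝ (Fin 3) → EuclideanSpace ℝ (Fin 3),
      ws = fun i y => fderiv ℝ w y (e i) := ⟨_, rfl⟩
  obtain ⟨us, hus⟩ : ∃ us : Fin 3 → EuclideanSpace ℝ (Fin 3) → EuclideanSpace ℝ (Fin 3),
      us = fun i y => fderiv ℝ u y (e i) := ⟨_, rfl⟩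
  have hws2 : ∀ i, ContDiff ℝ 2 (ws i) := fun i => by
    rw [hws]; exact (hw.fderiv_right (m := 2) (by norm_cast)).clm_apply contDiff_const
  have hws1 : ∀ i, ContDiff ℝ 1 (ws i) := fun i => (hws2 i).of_le (by norm_num)
  have hus1 : ∀ i, ContDiff ℝ 1 (us i) := fun i => by
    rw [hus]; exact (hu.fderiv_right (m := 1) (by norm_cast)).clm_apply contDiff_const
  -- continuity
  have cu : Continuous u := hu.continuous
  have cw : Continuous w := hw.continuous
  have cDu : Continuous (fderiv ℝ u) := hu1'.continuous_fderiv one_ne_zero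
  have cDw : Continuous (fderiv ℝ w) := hw1'.continuous_fderiv one_ne_zero
  have cws : ∀ i, Continuous (ws i) := fun i => (hws1 i).continuous
  have cDws : ∀ i, Continuous (fderiv ℝ (ws i)) := fun i => (hws1 i).continuous_fderiv one_ne_zero
  have cDus : ∀ i, Continuous (fderiv ℝ (us i)) := fun i => (hus1 i).continuous_fderiv one_ne_zero
  have cddw : ∀ i, Continuous fun x => fderiv ℝ (ws i) x (e i) := fun i =>
    (cDws i).clm_apply continuous_const
  have cF : Continuous F := by rw [hFdef]; exact cDu.clm_apply cw
  -- pointwise norm bounds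
  have hDw_eq : ∀ x, ‖fderiv ℝ w x‖ = ‖iteratedFDeriv ℝ 1 w x‖ := fun x => by
    rw [← norm_iteratedFDeriv_fderiv, norm_iteratedFDeriv_zero]
  have n_ws : ∀ i x, ‖ws i x‖ ≤ ‖fderiv ℝ w x‖ := fun i x => by
    rw [hws]; simpa [he1] using (fderiv ℝ w x).le_opNorm (e i)
  have n_Dws : ∀ i x, ‖fderiv ℝ (ws i) x‖ ≤ ‖iteratedFDeriv ℝ 2 w x‖ := fun i x => by
    have h : ‖fderiv ℝ (ws i) x‖ = ‖iteratedFDeriv ℝ 1 (ws i) x‖ := by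
      rw [← norm_iteratedFDeriv_fderiv, norm_iteratedFDeriv_zero]
    rw [h, hws]
    exact norm_iteratedFDeriv_fderiv_apply_basisFun_le hw 1 (by norm_cast) x i
  have n_ddw : ∀ i x, ‖fderiv ℝ (ws i) x (e i)‖ ≤ ‖iteratedFDeriv ℝ 2 w x‖ := fun i x => by
    have h1 : ‖fderiv ℝ (ws i) x (e i)‖ ≤ ‖fderiv ℝ (ws i) x‖ := by
      simpa [he1] using (fderiv ℝ (ws i) x).le_opNorm (e i)
    exact h1.trans (n_Dws i x)
  have n_Dus : ∀ i x, ‖fderiv ℝ (us i) x‖ ≤ B₂ := fun i x => by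
    have h : ‖fderiv ℝ (us i) x‖ = ‖iteratedFDeriv ℝ 1 (us i) x‖ := by
      rw [← norm_iteratedFDeriv_fderiv, norm_iteratedFDeriv_zero]
    rw [h, hus]
    exact (norm_iteratedFDeriv_fderiv_apply_basisFun_le hu 1 (by norm_cast) x i).trans (hB₂ x)
  have n_F : ∀ x, ‖F x‖ ≤ ‖B₁ * ‖w x‖‖ := fun x => by
    rw [hFdef, convect, Real.norm_of_nonneg (mul_nonneg hB₁0 (norm_nonneg _))]
    exact (fderiv ℝ u x).le_of_opNorm_le (hB₁ x) (w x)
  -- finite `L²` norms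
  have l2Dw : ∫⁻ x, ‖fderiv ℝ w x‖ₑ ^ 2 < ⊤ :=
    lintegral_enorm_sq_lt_top_of_norm_le (fun x => (hDw_eq x).le) hw1
  have l2ws : ∀ i, ∫⁻ x, ‖ws i x‖ₑ ^ 2 < ⊤ := fun i => lintegral_enorm_sq_lt_top_of_norm_le (n_ws i) l2Dw
  have l2Dws : ∀ i, ∫⁻ x, ‖fderiv ℝ (ws i) x‖ₑ ^ 2 < ⊤ := fun i =>
    lintegral_enorm_sq_lt_top_of_norm_le (n_Dws i) hw2
  have l2ddw : ∀ i, ∫⁻ x, ‖fderiv ℝ (ws i) x (e i)‖ₑ ^ 2 < ⊤ := fun i =>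
    lintegral_enorm_sq_lt_top_of_norm_le (n_ddw i) hw2
  have l2F : ∫⁻ x, ‖F x‖ₑ ^ 2 < ⊤ :=
    lintegral_enorm_sq_lt_top_of_norm_le n_F (r3rob_lintegral_sq_mul_norm_lt_top B₁ hw0)
  -- the derivative of `F`: `∂ᵢF = Du(∂ᵢw) + (w·∇)(∂ᵢu)`
  have hdF : ∀ i x, fderiv ℝ F x (e i) = fderiv ℝ u x (ws i x) + convect w (us i) x := by
    intro i x
    rw [hFdef, fderiv_convect_apply_of_contDiff hw hu x (e i), hws, hus]
  -- the two pieces and their integrability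
  have n_a : ∀ i x, ‖fderiv ℝ u x (ws i x)‖ ≤ ‖B₁ * ‖fderiv ℝ w x‖‖ := fun i x => by
    rw [Real.norm_of_nonneg (mul_nonneg hB₁0 (norm_nonneg _))]
    exact ((fderiv ℝ u x).le_of_opNorm_le (hB₁ x) (ws i x)).trans
      (mul_le_mul_of_nonneg_left (n_ws i x) hB₁0)
  have n_b : ∀ i x, ‖convect w (us i) x‖ ≤ ‖B₂ * ‖w x‖‖ := fun i x => by
    rw [convect, Real.norm_of_nonneg (mul_nonneg hB₂0 (norm_nonneg _))]
    exact (fderiv ℝ (us i) x).le_of_opNorm_le (n_Dus i x) (w x)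
  have ca : ∀ i, Continuous fun x => fderiv ℝ u x (ws i x) := fun i => cDu.clm_apply (cws i)
  have cb : ∀ i, Continuous (convect w (us i)) := fun i => (cDus i).clm_apply cw
  have l2a : ∀ i, ∫⁻ x, ‖fderiv ℝ u x (ws i x)‖ₑ ^ 2 < ⊤ := fun i =>
    lintegral_enorm_sq_lt_top_of_norm_le (n_a i) (r3rob_lintegral_sq_mul_norm_lt_top B₁ l2Dw)
  have l2b : ∀ i, ∫⁻ x, ‖convect w (us i) x‖ₑ ^ 2 < ⊤ := fun i =>
    lintegral_enorm_sq_lt_top_of_norm_le (n_b i) (r3rob_lintegral_sq_mul_norm_lt_top B₂ hw0)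
  have i2a : ∀ i, Integrable (fun x => ⟪ws i x, fderiv ℝ u x (ws i x)⟫) volume := fun i =>
    integrable_of_norm_le_mul_of_lintegral_sq ((cws i).inner (ca i)).aestronglyMeasurable (cws i) (ca i)
      (l2ws i) (l2a i) fun x => norm_inner_le_norm _ _
  have i2b : ∀ i, Integrable (fun x => ⟪ws i x, convect w (us i) x⟫) volume := fun i =>
    integrable_of_norm_le_mul_of_lintegral_sq ((cws i).inner (cb i)).aestronglyMeasurable (cws i) (cb i)
      (l2ws i) (l2b i) fun x => norm_inner_le_norm _ _
  -- integrability for the integration by parts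
  have i1 : ∀ i, Integrable (fun x => ⟪fderiv ℝ (fun y => fderiv ℝ w y (e i)) x (e i), F x⟫)
      volume := fun i => by
    have h : Integrable (fun x => ⟪fderiv ℝ (ws i) x (e i), F x⟫) volume :=
      integrable_of_norm_le_mul_of_lintegral_sq ((cddw i).inner cF).aestronglyMeasurable (cddw i)
        cF (l2ddw i) l2F fun x => norm_inner_le_norm _ _
    rw [hws] at h
    exact h
  have i2 : ∀ i, Integrable (fun x => ⟪fderiv ℝ w x (e i), fderiv ℝ F x (e i)⟫) volume := fun i => by
    have h := (i2a i).add (i2b i)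
    refine h.congr (Eventually.of_forall fun x => ?_)
    simp only [Pi.add_apply, hdF i x, inner_add_right, hws]
  have i3 : ∀ i, Integrable (fun x => ⟪fderiv ℝ w x (e i), F x⟫) volume := fun i => by
    have h : Integrable (fun x => ⟪ws i x, F x⟫) volume :=
      integrable_of_norm_le_mul_of_lintegral_sq ((cws i).inner cF).aestronglyMeasurable (cws i)
        cF (l2ws i) l2F fun x => norm_inner_le_norm _ _
    rw [hws] at h
    exact h
  -- integration by parts
  have hL := integral_sum_inner_fderiv_fderiv_eq_neg_integral_inner_laplacian hw2' hF i1 i2 i3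
  have hsplit : ∀ i, ∫ x, ⟪fderiv ℝ w x (e i), fderiv ℝ F x (e i)⟫ =
      (∫ x, ⟪ws i x, fderiv ℝ u x (ws i x)⟫) + ∫ x, ⟪ws i x, convect w (us i) x⟫ := by
    intro i
    have h1 : (fun x => ⟪fderiv ℝ w x (e i), fderiv ℝ F x (e i)⟫) =
        fun x => ⟪ws i x, fderiv ℝ u x (ws i x)⟫ + ⟪ws i x, convect w (us i) x⟫ :=
      funext fun x => by rw [hdF i x, inner_add_right, hws]
    rw [h1, integral_add (i2a i) (i2b i)]
  have hL' : ∫ x, ⟪(Δ w) x, F x⟫ = - ∫ x, ∑ i, ⟪fderiv ℝ w x (e i), fderiv ℝ F x (e i)⟫ := by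
    rw [hL, neg_neg]
  have i2a' : ∀ i, Integrable (fun x => ⟪fderiv ℝ w x (e i), fderiv ℝ u x (fderiv ℝ w x (e i))⟫)
      volume := fun i => by
    have h := i2a i
    rw [hws] at h
    exact h
  have i2b' : ∀ i, Integrable (fun x => ⟪fderiv ℝ w x (e i),
      convect w (fun y => fderiv ℝ u y (e i)) x⟫) volume := fun i => by
    have h := i2b i
    rw [hws, hus] at h
    exact h
  refine ⟨integrable_finsetSum _ fun i _ => i2a' i, integrable_finsetSum _ fun i _ => i2b' i, ?_⟩
  rw [← hFdef, hL', integral_finsetSum _ fun i _ => i2 i, Finset.sum_congr rfl fun i _ => hsplit i,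
    Finset.sum_add_distrib, ← integral_finsetSum _ fun i _ => i2a i,
    ← integral_finsetSum _ fun i _ => i2b i, hws, hus]
  ring

/-- `2Ls ≤ κ s² + L²/κ` for `κ > 0`. [folklore] -/
private theorem r3rob_two_mul_le_kappa {L s κ : ℝ} (hκ : 0 < κ) : 2 * L * s ≤ κ * s ^ 2 + L ^ 2 / κ := by
  have h : 2 * L * s - κ * s ^ 2 ≤ L ^ 2 / κ := by
    rw [le_div_iff₀ hκ]
    nlinarith [sq_nonneg (κ * s - L)]
  linarith

/-- **The slice inequality in STRAIN form with the Agmon constant as a PARAMETER `A` (`AgmonBoundR3 A`)** —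
verbatim `robustness_flux_le_strain_R3` (cstrat-19179's (I1)–(I2) by parts; RRS 2016, proof of
Thm 9.1, Step 1, with the transport term integrated out), explicit constants.** Let `u, w : ℝ³ → ℝ³`
be `C^∞` with `div u = 0`, `u, Du, D²u` bounded, `w, Dw, D²w, D³w ∈ L²`, let `h ∈ L²` be continuous,
and put `v = u + w`, `X = ∫|∇w|²_F`, `Y = ∫‖Δw‖²`. Suppose
`−⟪Du(x)ξ, ξ⟫ ≤ G‖ξ‖²` for all `x, ξ` (`G` = a bound of the maximal COMPRESSION rate
`λ_max(−sym Du)` of the reference), `‖D²u(x)‖ ≤ σ₂`, `(∫‖w‖²)^{1/2} ≤ L`, and let `κ > 0` be a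
free length. Then
`−2νY + 2∫⟪(v·∇)w + (w·∇)u, Δw⟫ + 2∫⟪h, Δw⟫`
`  ≤ (4G + 3κσ₂) X + A⁴X³/(2ν³) + (2/ν)∫‖h‖² + (3σ₂/κ) L²`.
The sup of `u` never enters: `∫⟪(u·∇)w, Δw⟫ = −Σᵢ∫⟪∇wᵢ, Du∇wᵢ⟫ ≤ G X` (transport by `u` drops
out, `div u = 0`), `∫⟪(w·∇)u, Δw⟫ = −Σₖ∫⟪∂ₖw, Du∂ₖw⟫ − Σₖ∫⟪∂ₖw, (w·∇)∂ₖu⟫ ≤ G X + 3σ₂L√X`,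
the cubic term `∫⟪(w·∇)w, Δw⟫ ≤ A(XY)^{1/4}√X√Y` is absorbed by three quarters of the dissipation
(Young `4`–`4/3`; the only place `A` and `ν⁻³` enter), the forcing pairing by the last quarter.
[cite: RobinsonRodrigoSadowskiCUP2016, Thm 9.1 (proof, Step 1, (9.2)–(9.3))] -/
theorem robustness_flux_le_strain_of_agmonBound {A : ℝ} (hA : AgmonBoundR3 A) {ν : ℝ} (hν : 0 < ν)
    {u w h : EuclideanSpace ℝ (Fin 3) → EuclideanSpace ℝ (Fin 3)} (hu : ContDiff ℝ ∞ u)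
    (hw : ContDiff ℝ ∞ w) (hh : Continuous h) (hdivu : VectorCalculus.IsDivFree u)
    (hwn : ∀ n : ℕ, ∫⁻ x, ‖iteratedFDeriv ℝ n w x‖ₑ ^ 2 < ⊤)
    (hh0 : ∫⁻ x, ‖h x‖ₑ ^ 2 < ⊤) {B : ℝ} (hB : ∀ x, ‖u x‖ ≤ B)
    {B₁ : ℝ} (hB₁ : ∀ x, ‖fderiv ℝ u x‖ ≤ B₁)
    {G : ℝ} (hG : ∀ x (ξ : EuclideanSpace ℝ (Fin 3)), -⟪fderiv ℝ u x ξ, ξ⟫ ≤ G * ‖ξ‖ ^ 2)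
    {σ₂ : ℝ} (hσ₂ : ∀ x, ‖iteratedFDeriv ℝ 2 u x‖ ≤ σ₂)
    {L : ℝ} (hL : Real.sqrt (∫ x, ‖w x‖ ^ 2) ≤ L) {κ : ℝ} (hκ : 0 < κ) :
    -(2 * ν * ∫ x, ‖(Δ w) x‖ ^ 2) +
        2 * (∫ x, ⟪convect (fun y => u y + w y) w x + convect w u x, (Δ w) x⟫) +
        2 * (∫ x, ⟪h x, (Δ w) x⟫) ≤
      (4 * G + 3 * κ * σ₂) * (∫ x, frobeniusNormSq (fderiv ℝ w x)) +
        A ^ 4 * (∫ x, frobeniusNormSq (fderiv ℝ w x)) ^ 3 / (2 * ν ^ 3) +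
        2 / ν * (∫ x, ‖h x‖ ^ 2) + 3 * σ₂ / κ * L ^ 2 := by
  have hw0 := hwn 0
  have hw1 := hwn 1
  have hw2 := hwn 2
  have hw3 := hwn 3
  set e := EuclideanSpace.basisFun (Fin 3) ℝ with he
  have he1 : ∀ i, ‖e i‖ = 1 := fun i => by simp [he]
  -- regularity of the players
  have hw1' : ContDiff ℝ 1 w := hw.of_le (by norm_cast)
  have hu1' : ContDiff ℝ 1 u := hu.of_le (by norm_cast)
  have cw : Continuous w := hw.continuous
  have cu : Continuous u := hu.continuous
  have cDw : Continuous (fderiv ℝ w) := hw1'.continuous_fderiv one_ne_zero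
  have cΔ : Continuous fun x => (Δ w) x :=
    (contDiff_one_laplacian_of_contDiff_three (hw.of_le (by norm_cast))).continuous
  have hσ₂0 : 0 ≤ σ₂ := (norm_nonneg _).trans (hσ₂ 0)
  have hL0 : 0 ≤ L := (Real.sqrt_nonneg _).trans hL
  -- `L²` finiteness of `w`, `∇w` (Frobenius and operator forms) and of `Δw`
  have hw0' : ∫⁻ x, ‖w x‖ₑ ^ 2 < ⊤ := by
    refine lt_of_le_of_lt (le_of_eq (lintegral_congr fun x => ?_)) hw0
    rw [← ofReal_norm, ← ofReal_norm, norm_iteratedFDeriv_zero]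
  have hw1F : ∫⁻ x, ENNReal.ofReal (frobeniusNormSq (fderiv ℝ w x)) < ⊤ := by
    calc ∫⁻ x, ENNReal.ofReal (frobeniusNormSq (fderiv ℝ w x))
        ≤ ∫⁻ x, 3 * ‖iteratedFDeriv ℝ 1 w x‖ₑ ^ 2 := lintegral_mono fun x => by
          rw [← ofReal_norm, norm_iteratedFDeriv_one, ofReal_norm]
          exact ofReal_frobeniusNormSq_le_three_mul_enorm_sq _
      _ = 3 * ∫⁻ x, ‖iteratedFDeriv ℝ 1 w x‖ₑ ^ 2 := lintegral_const_mul' _ _ (by norm_num)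
      _ < ⊤ := ENNReal.mul_lt_top (by norm_num) hw1
  have hDw_eq : ∀ x, ‖fderiv ℝ w x‖ = ‖iteratedFDeriv ℝ 1 w x‖ := fun x => by
    rw [← norm_iteratedFDeriv_fderiv, norm_iteratedFDeriv_zero]
  have l2Dw : ∫⁻ x, ‖fderiv ℝ w x‖ₑ ^ 2 < ⊤ :=
    lintegral_enorm_sq_lt_top_of_norm_le (fun x => (hDw_eq x).le) hw1
  have hΔ2 : ∫⁻ x, ‖(Δ w) x‖ₑ ^ 2 < ⊤ := by
    have hle : ∀ x, ‖(Δ w) x‖ ≤ ‖(3 : ℝ) • iteratedFDeriv ℝ 2 w x‖ := fun x => by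
      rw [norm_smul, Real.norm_of_nonneg (by norm_num : (0 : ℝ) ≤ 3)]
      exact norm_laplacian_le_three_mul_norm_iteratedFDeriv_two (hw.of_le (by norm_cast)) x
    have h9 : ∫⁻ x, ‖(3 : ℝ) • iteratedFDeriv ℝ 2 w x‖ₑ ^ 2 < ⊤ := by
      have e3 : ∀ x, ‖(3 : ℝ) • iteratedFDeriv ℝ 2 w x‖ₑ ^ 2 =
          ENNReal.ofReal 3 ^ 2 * ‖iteratedFDeriv ℝ 2 w x‖ₑ ^ 2 := fun x => by
        rw [enorm_smul, mul_pow, Real.enorm_eq_ofReal (by norm_num : (0 : ℝ) ≤ 3)]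
      simp_rw [e3]
      rw [lintegral_const_mul' _ _ (ENNReal.pow_ne_top ENNReal.ofReal_ne_top)]
      exact ENNReal.mul_lt_top (lt_top_iff_ne_top.2 (ENNReal.pow_ne_top ENNReal.ofReal_ne_top)) hw2
    exact lintegral_enorm_sq_lt_top_of_norm_le hle h9
  -- integrability of `|∇w|²_F`
  have ifrob : Integrable (fun x => frobeniusNormSq (fderiv ℝ w x)) volume :=
    integrable_of_continuous_of_nonneg (FluidPDE.continuous_frobeniusNormSq_fderiv hw1' one_ne_zero)
      (fun x => frobeniusNormSq_nonneg _) hw1F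
  -- freeze the integrals and the constant
  obtain ⟨X, hX⟩ : ∃ X : ℝ, X = ∫ x, frobeniusNormSq (fderiv ℝ w x) := ⟨_, rfl⟩
  obtain ⟨Y, hY⟩ : ∃ Y : ℝ, Y = ∫ x, ‖(Δ w) x‖ ^ 2 := ⟨_, rfl⟩
  obtain ⟨H, hH⟩ : ∃ H : ℝ, H = ∫ x, ‖h x‖ ^ 2 := ⟨_, rfl⟩
  rw [← hX, ← hY, ← hH]
  have hA0 : 0 ≤ A := hA.nonneg
  have hX0 : 0 ≤ X := by rw [hX]; exact integral_nonneg fun x => frobeniusNormSq_nonneg _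
  have hY0 : 0 ≤ Y := by rw [hY]; exact integral_nonneg fun x => sq_nonneg _
  have hH0 : 0 ≤ H := by rw [hH]; exact integral_nonneg fun x => sq_nonneg _
  -- split the advecting field
  have hsplit : ∀ x, convect (fun y => u y + w y) w x = convect u w x + convect w w x := by
    intro x
    simp only [convect, map_add]
  -- Agmon for `w`: a sup bound `Mw` with `Mw⁴ = A⁴ X Y`
  obtain ⟨Mw, hMw⟩ : ∃ Mw : ℝ, Mw = A * (X * Y) ^ (1 / 4 : ℝ) := ⟨_, rfl⟩
  have hMw0 : 0 ≤ Mw := by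
    rw [hMw]; exact mul_nonneg hA0 (Real.rpow_nonneg (mul_nonneg hX0 hY0) _)
  have hMw4 : Mw ^ 4 = A ^ 4 * X * Y := by
    have h4 : ((X * Y) ^ (1 / 4 : ℝ)) ^ 4 = X * Y := by
      rw [← Real.rpow_natCast, ← Real.rpow_mul (mul_nonneg hX0 hY0)]
      norm_num
    rw [hMw, mul_pow, h4]
    ring
  have hMwx : ∀ x, ‖w x‖ ≤ Mw := fun x => by
    rw [hMw, hX, hY]
    exact hA.norm_le hw hwn x
  -- (I1) transport term by parts: `∫⟪(u·∇)w, Δw⟫ ≤ G X`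
  have hT1 : ∫ x, ⟪convect u w x, (Δ w) x⟫ ≤ G * X := by
    obtain ⟨iS, hid⟩ := integral_inner_laplacian_convect_left_eq_neg_sum hu hw hdivu hB hB₁ hw1 hw2
    have hcomm : ∫ x, ⟪convect u w x, (Δ w) x⟫ = ∫ x, ⟪(Δ w) x, convect u w x⟫ :=
      integral_congr_ae (Eventually.of_forall fun x => real_inner_comm _ _)
    rw [hcomm, hid, ← integral_neg, hX, ← integral_const_mul]
    refine integral_mono iS.neg (ifrob.const_mul G) fun x => ?_
    exact r3rob_neg_sum_inner_comp_le (fderiv ℝ u x) (fderiv ℝ w x) (hG x)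
  -- (I3) the cubic term
  have hT2 : ∫ x, ⟪convect w w x, (Δ w) x⟫ ≤ Mw * Real.sqrt X * Real.sqrt Y := by
    rw [hX, hY]; exact integral_inner_convect_le_of_norm_le hw1' cΔ hMw0 hMwx hw1F hΔ2
  -- (I2) stretching term by parts: `∫⟪(w·∇)u, Δw⟫ ≤ G X + 3σ₂ L √X`
  have hT3 : ∫ x, ⟪convect w u x, (Δ w) x⟫ ≤ G * X + 3 * σ₂ * L * Real.sqrt X := by
    obtain ⟨iS, iR, hid⟩ := integral_inner_laplacian_convect_right_eq_neg_sum hu hw hB₁ hσ₂ hw0' hw1 hw2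
    have hcomm : ∫ x, ⟪convect w u x, (Δ w) x⟫ = ∫ x, ⟪(Δ w) x, convect w u x⟫ :=
      integral_congr_ae (Eventually.of_forall fun x => real_inner_comm _ _)
    rw [hcomm, hid]
    -- first quadratic form
    have h1 : -(∫ x, ∑ i, ⟪fderiv ℝ w x (e i), fderiv ℝ u x (fderiv ℝ w x (e i))⟫) ≤ G * X := by
      rw [← integral_neg, hX, ← integral_const_mul]
      refine integral_mono iS.neg (ifrob.const_mul G) fun x => ?_
      exact r3rob_neg_sum_inner_le (fderiv ℝ u x) (fderiv ℝ w x) (hG x)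
    -- the cross term `Σₖ ⟪∂ₖw, (w·∇)∂ₖu⟫`
    have h2 : -(∫ x, ∑ i, ⟪fderiv ℝ w x (e i), convect w (fun y => fderiv ℝ u y (e i)) x⟫) ≤
        3 * σ₂ * L * Real.sqrt X := by
      -- pointwise: `|Σᵢ ⟪∂ᵢw, D(∂ᵢu)(w)⟫| ≤ σ₂ ‖w‖ Σᵢ ‖∂ᵢw‖ ≤ 3 σ₂ ‖w‖ ‖Dw‖`
      have n_Dus : ∀ i x, ‖fderiv ℝ (fun y => fderiv ℝ u y (e i)) x‖ ≤ σ₂ := fun i x => by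
        have h : ‖fderiv ℝ (fun y => fderiv ℝ u y (e i)) x‖ =
            ‖iteratedFDeriv ℝ 1 (fun y => fderiv ℝ u y (e i)) x‖ := by
          rw [← norm_iteratedFDeriv_fderiv, norm_iteratedFDeriv_zero]
        rw [h]
        exact (norm_iteratedFDeriv_fderiv_apply_basisFun_le hu 1 (by norm_cast) x i).trans (hσ₂ x)
      have hpt : ∀ x, -(∑ i, ⟪fderiv ℝ w x (e i), convect w (fun y => fderiv ℝ u y (e i)) x⟫) ≤
          3 * σ₂ * (‖w x‖ * ‖fderiv ℝ w x‖) := by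
        intro x
        have hi : ∀ i, -⟪fderiv ℝ w x (e i), convect w (fun y => fderiv ℝ u y (e i)) x⟫ ≤
            σ₂ * (‖w x‖ * ‖fderiv ℝ w x‖) := by
          intro i
          have hc : ‖convect w (fun y => fderiv ℝ u y (e i)) x‖ ≤ σ₂ * ‖w x‖ := by
            rw [convect]
            exact (fderiv ℝ (fun y => fderiv ℝ u y (e i)) x).le_of_opNorm_le (n_Dus i x) (w x)
          have hd : ‖fderiv ℝ w x (e i)‖ ≤ ‖fderiv ℝ w x‖ := by
            simpa [he1] using (fderiv ℝ w x).le_opNorm (e i)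
          calc -⟪fderiv ℝ w x (e i), convect w (fun y => fderiv ℝ u y (e i)) x⟫
              ≤ ‖fderiv ℝ w x (e i)‖ * ‖convect w (fun y => fderiv ℝ u y (e i)) x‖ :=
                (neg_le_abs _).trans (abs_real_inner_le_norm _ _)
            _ ≤ ‖fderiv ℝ w x‖ * (σ₂ * ‖w x‖) :=
                mul_le_mul hd hc (norm_nonneg _) (norm_nonneg _)
            _ = σ₂ * (‖w x‖ * ‖fderiv ℝ w x‖) := by ring
        rw [← Finset.sum_neg_distrib]
        calc ∑ i, -⟪fderiv ℝ w x (e i), convect w (fun y => fderiv ℝ u y (e i)) x⟫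
            ≤ ∑ _i : Fin 3, σ₂ * (‖w x‖ * ‖fderiv ℝ w x‖) := Finset.sum_le_sum fun i _ => hi i
          _ = 3 * σ₂ * (‖w x‖ * ‖fderiv ℝ w x‖) := by
              rw [Finset.sum_const, Finset.card_univ, Fintype.card_fin, nsmul_eq_mul]
              push_cast
              ring
      have mw : MemLp w 2 volume := r3rob_memLp_two cw hw0'
      have mDw : MemLp (fderiv ℝ w) 2 volume := r3rob_memLp_two cDw l2Dw
      have hcs := integral_norm_mul_norm_le_sqrt_mul_sqrt mw mDw
      have iprod : Integrable (fun x => ‖w x‖ * ‖fderiv ℝ w x‖) volume :=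
        integrable_of_norm_le_mul_of_lintegral_sq ((cw.norm.mul cDw.norm).aestronglyMeasurable) cw cDw
          hw0' l2Dw (fun x => by rw [Real.norm_of_nonneg (mul_nonneg (norm_nonneg _) (norm_nonneg _))])
      have hXop : Real.sqrt (∫ x, ‖fderiv ℝ w x‖ ^ 2) ≤ Real.sqrt X := by
        refine Real.sqrt_le_sqrt ?_
        rw [hX]
        refine integral_mono (FluidPDE.integrable_sq_norm_of_lintegral_lt_top cDw l2Dw) ifrob fun x => ?_
        exact FluidPDE.sq_opNorm_le_frobeniusNormSq _
      rw [← integral_neg]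
      calc ∫ x, -(∑ i, ⟪fderiv ℝ w x (e i), convect w (fun y => fderiv ℝ u y (e i)) x⟫)
          ≤ ∫ x, 3 * σ₂ * (‖w x‖ * ‖fderiv ℝ w x‖) := integral_mono iR.neg (iprod.const_mul _) hpt
        _ = 3 * σ₂ * ∫ x, ‖w x‖ * ‖fderiv ℝ w x‖ := integral_const_mul _ _
        _ ≤ 3 * σ₂ * (Real.sqrt (∫ x, ‖w x‖ ^ 2) * Real.sqrt (∫ x, ‖fderiv ℝ w x‖ ^ 2)) :=
            mul_le_mul_of_nonneg_left hcs (by positivity)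
        _ ≤ 3 * σ₂ * (L * Real.sqrt X) :=
            mul_le_mul_of_nonneg_left (mul_le_mul hL hXop (Real.sqrt_nonneg _) hL0) (by positivity)
        _ = 3 * σ₂ * L * Real.sqrt X := by ring
    linarith [h1, h2]
  -- the forcing pairing
  have hT4 : ∫ x, ⟪h x, (Δ w) x⟫ ≤ Real.sqrt H * Real.sqrt Y := by
    rw [hH, hY]
    have mh : MemLp h 2 volume := r3rob_memLp_two hh hh0
    have mΔ : MemLp (fun x => (Δ w) x) 2 volume := r3rob_memLp_two cΔ hΔ2
    have hcs := integral_norm_mul_norm_le_sqrt_mul_sqrt mh mΔ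
    by_cases hint : Integrable (fun x => ⟪h x, (Δ w) x⟫) volume
    · refine le_trans (integral_mono hint ?_ fun x => real_inner_le_norm (h x) ((Δ w) x)) hcs
      exact integrable_of_norm_le_mul_of_lintegral_sq ((hh.norm.mul cΔ.norm).aestronglyMeasurable)
        hh cΔ hh0 hΔ2 (fun x => by
          rw [Real.norm_of_nonneg (mul_nonneg (norm_nonneg _) (norm_nonneg _))])
    · rw [integral_undef hint]; positivity
  -- the sum of the pairings
  have i1 : Integrable (fun x => ⟪convect u w x, (Δ w) x⟫) volume :=
    integrable_inner_convect_of_norm_le cu hw1' cΔ ((norm_nonneg _).trans (hB 0)) hB hw1F hΔ2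
  have i2 : Integrable (fun x => ⟪convect w w x, (Δ w) x⟫) volume :=
    integrable_inner_convect_of_norm_le cw hw1' cΔ hMw0 hMwx hw1F hΔ2
  have i3 : Integrable (fun x => ⟪convect w u x, (Δ w) x⟫) volume := by
    -- `‖(w·∇)u‖ ≤ B₁‖w‖ ∈ L²`
    have n : ∀ x, ‖convect w u x‖ ≤ ‖B₁ * ‖w x‖‖ := fun x => by
      rw [convect, Real.norm_of_nonneg (mul_nonneg ((norm_nonneg _).trans (hB₁ 0)) (norm_nonneg _))]
      exact (fderiv ℝ u x).le_of_opNorm_le (hB₁ x) (w x)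
    have l2 : ∫⁻ x, ‖convect w u x‖ₑ ^ 2 < ⊤ :=
      lintegral_enorm_sq_lt_top_of_norm_le n (r3rob_lintegral_sq_mul_norm_lt_top B₁ hw0')
    have cc : Continuous (convect w u) := (hu1'.continuous_fderiv one_ne_zero).clm_apply cw
    exact integrable_of_norm_le_mul_of_lintegral_sq (cc.inner cΔ).aestronglyMeasurable cc cΔ l2 hΔ2
      fun x => norm_inner_le_norm _ _
  have hsum : ∫ x, ⟪convect (fun y => u y + w y) w x + convect w u x, (Δ w) x⟫ =
      (∫ x, ⟪convect u w x, (Δ w) x⟫) + (∫ x, ⟪convect w w x, (Δ w) x⟫) +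
        ∫ x, ⟪convect w u x, (Δ w) x⟫ := by
    have eq : ∀ x, ⟪convect (fun y => u y + w y) w x + convect w u x, (Δ w) x⟫ =
        ⟪convect u w x, (Δ w) x⟫ + ⟪convect w w x, (Δ w) x⟫ + ⟪convect w u x, (Δ w) x⟫ := by
      intro x; rw [hsplit x, inner_add_left, inner_add_left]
    have i12 : Integrable (fun x => ⟪convect u w x, (Δ w) x⟫ + ⟪convect w w x, (Δ w) x⟫) volume :=
      i1.add i2
    simp_rw [eq]
    rw [integral_add i12 i3, integral_add i1 i2]
  -- Young
  have hν2 : 0 < 3 * ν / 4 := by positivity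
  have hY2 : Mw * Real.sqrt X * Real.sqrt Y ≤
      3 * ν / 4 * Y + 27 * (A ^ 4 * X ^ 3) / (256 * (3 * ν / 4) ^ 3) := by
    refine r3rob_young_quartic (by positivity) (by positivity) hY0 hν2 ?_
    have eq : (Mw * Real.sqrt X * Real.sqrt Y) ^ 4 =
        Mw ^ 4 * (Real.sqrt X ^ 2) ^ 2 * (Real.sqrt Y ^ 2) ^ 2 := by ring
    rw [eq, hMw4, Real.sq_sqrt hX0, Real.sq_sqrt hY0]
    exact le_of_eq (by ring)
  have hY4 : Real.sqrt H * Real.sqrt Y ≤ ν / 4 * Y + H / ν := by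
    have h := r3rob_young_two (M := 1) hν hH0 hY0
    rw [one_mul, one_pow, one_mul] at h
    exact h
  have hY3 : 2 * L * Real.sqrt X ≤ κ * X + L ^ 2 / κ := by
    have h := r3rob_two_mul_le_kappa (L := L) (s := Real.sqrt X) hκ
    rwa [Real.sq_sqrt hX0] at h
  -- assemble (scalar bookkeeping on frozen pairings)
  have hS : (∫ x, ⟪convect (fun y => u y + w y) w x + convect w u x, (Δ w) x⟫) ≤
      G * X + (3 * ν / 4 * Y + 27 * (A ^ 4 * X ^ 3) / (256 * (3 * ν / 4) ^ 3)) +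
        (G * X + 3 * σ₂ * L * Real.sqrt X) := by
    rw [hsum]
    exact add_le_add (add_le_add hT1 (hT2.trans hY2)) hT3
  have hF : (∫ x, ⟪h x, (Δ w) x⟫) ≤ ν / 4 * Y + H / ν := hT4.trans hY4
  generalize (∫ x, ⟪convect (fun y => u y + w y) w x + convect w u x, (Δ w) x⟫) = Pa at hS ⊢
  generalize (∫ x, ⟪h x, (Δ w) x⟫) = Pb at hF ⊢
  have hid : 27 * (A ^ 4 * X ^ 3) / (256 * (3 * ν / 4) ^ 3) = A ^ 4 * X ^ 3 / (4 * ν ^ 3) := by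
    field_simp
    ring
  rw [hid] at hS
  have hcross : 3 * σ₂ * L * Real.sqrt X ≤ 3 / 2 * σ₂ * (κ * X + L ^ 2 / κ) := by
    have := mul_le_mul_of_nonneg_left hY3 (by positivity : (0 : ℝ) ≤ 3 / 2 * σ₂)
    linarith [this]
  have hid2 : (4 * G + 3 * κ * σ₂) * X + A ^ 4 * X ^ 3 / (2 * ν ^ 3) + 2 / ν * H +
      3 * σ₂ / κ * L ^ 2 =
      -(2 * ν * Y) + 2 * (G * X + (3 * ν / 4 * Y + A ^ 4 * X ^ 3 / (4 * ν ^ 3)) +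
        (G * X + 3 / 2 * σ₂ * (κ * X + L ^ 2 / κ))) + 2 * (ν / 4 * Y + H / ν) := by
    field_simp
    ring
  rw [hid2]
  linarith [hS, hF, hcross]

end Strain

end Literature.Analysis.FluidPDE
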